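import Summits.QuantumFields.YangMills.Theorems.FemtoTransferGapSpectralSums
import HarnessLib

/-!
# Femto transfer gap — the WEINSTEIN (Krylov–Bogoliubov) ENCLOSURE for the zero-flux transfer operator: a residual `r = K_β v − m·v` of a physical
# vector locates a running level `λ_j = levelValue su2Rep L β j` within `‖r‖·√(λ₀/⟨v,K_βv⟩)` of `m` (support module for crux `DressedRitz`,
# stmt-QuantumFields-20205; prover seat ymfull-r2b-prover-1, cell ym-gapexp)

WHAT.  On a fixed lattice (`L`, `β > 0`) let `e_k` be the physical `l2`-orthonormal exact eigen-sequence of `K_β` with exact spectral sums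
(`SpecSum.exists_spectral_eigenseq`): `⟨K^m w, K^n v⟩ = Σ_k λ_k^{m+n} ⟨w,e_k⟩⟨v,e_k⟩` (`m+n ≥ 1`) and Bessel `Σ_k ⟨v,e_k⟩² ≤ ⟨v,v⟩`.  For a physical `v`,
any real `m` and `r = K_βv − m v`:
  `‖r‖² = ⟨Kv,Kv⟩ − 2m⟨v,Kv⟩ + m²⟨v,v⟩ ≥ Σ_k (λ_k − m)² ⟨v,e_k⟩²`   and   `⟨v,K_βv⟩ = Σ_k λ_k⟨v,e_k⟩² ≤ λ₀ Σ_k ⟨v,e_k⟩²`,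
so if NO level lies in the open window `(λ_k − m)² > ρ` for all `k`, then `ρ·⟨v,K_βv⟩ < ‖r‖²·λ₀` (strict: some `⟨v,e_k⟩ ≠ 0` as soon as `⟨v,K_βv⟩ > 0`).

* ★ `Weinstein.exclusion` — the statement just described (physical-subspace packaging `physSubmodule ∕ l2Form ∕ transferOp`);
* ★ `Weinstein.inclusion : 0 < ⟨x,K_βx⟩ → ∃ j, (λ_j − m)²·⟨x,K_βx⟩ ≤ ‖K_βx − m x‖²·λ₀` (division-free located-level form), and the raw-function
  wrapper `Weinstein.inclusion'` for `v : GaugeConfig 3 L SU2 → ℝ`, `IsPhys v`, `r = transferApply β v − m • v`;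
* `Weinstein.residual_expand` — `‖K x − m x‖² = ⟨Kx,Kx⟩ − 2m⟨x,Kx⟩ + m²⟨x,x⟩` in the dictionary of `…KTPhysSpace`.

WHY (item 20205, clause (ii′)).  The residual-Gram clause of `DressedRitz` at a single coefficient vector gives `‖r_i‖² ≤ C(Λ³/L²)·m₀²` for each
member of the Ritz family; by `inclusion` each Ritz value `m_i` then has a TRUE running level within `√(C·λ₀m₀²/m_i)·Λ^{3/2}/L` — finer than the
zero-mode level spacing `≍ Λ/L` as `Λ → 0`.  This is what the exponent `3` in (ii′) buys WITHOUT any no-intruder hypothesis (index-free existence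
half of the handover); a rate `Λ²/L` would locate nothing (radius `Λ/√L ≫ Λ/L`).  The corollary for the item's slices is filed separately
(`…DressedRitzLocatedLevels`), keeping this engine out of the route cone.

HONEST FRAMING: fixed-lattice functional analysis (any `L`, `β > 0`); nothing here bears on infinite volume, the continuum limit or the Clay gap;
the Yang–Mills mass gap is NOT proved.  References: D. H. Weinstein, Proc. Natl. Acad. Sci. 20 (1934) 529; Reed–Simon IV, Thm. XIII.1
[cite: ReedSimonIV1978, Thm. XIII.1]; T. Kato, J. Phys. Soc. Japan 4 (1949) 334 [cite: Kato1949, Lemma 1].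
-/

set_option autoImplicit false

noncomputable section

open MeasureTheory Filter Topology Real
open Literature.MathematicalPhysics.QuantumFieldTheory
open Literature.MathematicalPhysics.QuantumLattice
open scoped BigOperators

namespace Summit.QuantumFields.YangMills.Theorems.FemtoTransferGap.Weinstein

open Summit.QuantumFields.YangMills.Theorems.FemtoTransferGap
open Summit.QuantumFields.YangMills.Theorems.FemtoTransferGap.SpecSum

variable {L : ℕ} [NeZero L]

/-! ## §1 Residual algebra in the physical subspace -/

/-- `‖K_βx − m·x‖² = ⟨Kx,Kx⟩ − 2m⟨x,Kx⟩ + m²⟨x,x⟩` (bilinearity of `l2Form`, `l2`-symmetry of `K_β`). [folklore] -/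
theorem residual_expand (β m : ℝ) (x : physSubmodule L) :
    l2Form L (transferOp β x - m • x) (transferOp β x - m • x) =
      l2Form L (transferOp β x) (transferOp β x) - 2 * m * l2Form L x (transferOp β x) + m ^ 2 * l2Form L x x := by
  simp only [map_sub, map_smul, LinearMap.sub_apply, LinearMap.smul_apply, smul_eq_mul]
  rw [transferOp_symm β x x]
  ring

/-! ## §2 ★ The Weinstein exclusion and inclusion bounds -/

/-- ★ **WEINSTEIN EXCLUSION.**  If every running level avoids the window, `ρ < (λ_k − m)²` for all `k`, and `⟨x,K_βx⟩ > 0`, then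
`ρ·⟨x,K_βx⟩ < ‖K_βx − m x‖²·λ₀`. [cite: ReedSimonIV1978, Thm. XIII.1] [cite: Kato1949, Lemma 1] -/
theorem exclusion {β : ℝ} (hβ : 0 < β) (x : physSubmodule L) (m ρ : ℝ)
    (hρ : ∀ k : ℕ, ρ < (levelValue su2Rep L β k - m) ^ 2) (hx : 0 < l2Form L x (transferOp β x)) :
    ρ * l2Form L x (transferOp β x) <
      l2Form L (transferOp β x - m • x) (transferOp β x - m • x) * levelValue su2Rep L β 0 := by
  obtain ⟨e, hon, heig, hdom, hsum, hbessel⟩ := exists_spectral_eigenseq (L := L) hβ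
  set v : GaugeConfig 3 L SU2 → ℝ := (x : GaugeConfig 3 L SU2 → ℝ) with hvdef
  have hv : IsPhys v := x.2
  set lam : ℕ → ℝ := fun k => levelValue su2Rep L β k with hlam
  set a : ℕ → ℝ := fun k => l2 v ((e k : physSubmodule L) : GaugeConfig 3 L SU2 → ℝ) with ha
  have hl0 : 0 < lam 0 := levelValue_zero_su2Rep_pos L β
  -- dictionary
  have hQ1 : l2Form L x (transferOp β x) = l2 v (transferApply β v) := by rw [l2Form_apply, coe_transferOp]
  have hQ2 : l2Form L (transferOp β x) (transferOp β x) = l2 (transferApply β v) (transferApply β v) := by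
    rw [l2Form_apply, coe_transferOp]
  have hN : l2Form L x x = l2 v v := l2Form_apply x x
  -- exact spectral sums
  have S1 : HasSum (fun k => lam k * a k ^ 2) (l2 v (transferApply β v)) := by
    have h := hsum v v hv hv 0 1 (by norm_num)
    simp only [zero_add, pow_one, Function.iterate_zero, Function.iterate_one, id_eq] at h
    exact h.congr_fun fun k => by simp only [hlam, ha]; ring
  have S2 : HasSum (fun k => lam k ^ 2 * a k ^ 2) (l2 (transferApply β v) (transferApply β v)) := by
    have h := hsum v v hv hv 1 1 (by norm_num)
    simp only [Function.iterate_one] at h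
    exact h.congr_fun fun k => by simp only [hlam, ha]; ring
  obtain ⟨hBs, hBle⟩ := hbessel v hv
  have SB : HasSum (fun k => a k ^ 2) (∑' k, a k ^ 2) := hBs.hasSum
  -- `λ_k ≤ λ_0` from Courant–Fischer domination at level `0` applied to `e_k`
  have hlamle : ∀ k, lam k ≤ lam 0 := by
    intro k
    have hek : IsPhys ((e k : physSubmodule L) : GaugeConfig 3 L SU2 → ℝ) := (e k).2
    have h := hdom 0 _ hek (fun i hi => absurd hi (Nat.not_lt_zero i))
    rw [qform_eq_l2_transferApply, heig k, l2_comm, l2_smul_left, hon k k, if_pos rfl] at h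
    simpa using h
  -- the spectral form of `‖r‖²`, bounded above by `‖r‖²` (Bessel on the `m²` term)
  have hT : HasSum (fun k => (lam k - m) ^ 2 * a k ^ 2)
      (l2 (transferApply β v) (transferApply β v) - 2 * m * l2 v (transferApply β v) + m ^ 2 * ∑' k, a k ^ 2) := by
    have h := (S2.sub (S1.mul_left (2 * m))).add (SB.mul_left (m ^ 2))
    exact h.congr_fun fun k => by ring
  have hres : l2 (transferApply β v) (transferApply β v) - 2 * m * l2 v (transferApply β v) + m ^ 2 * ∑' k, a k ^ 2 ≤
      l2Form L (transferOp β x - m • x) (transferOp β x - m • x) := by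
    rw [residual_expand, hQ1, hQ2, hN]
    nlinarith [mul_le_mul_of_nonneg_left hBle (sq_nonneg m)]
  -- some coefficient is nonzero
  have hne : ∃ k0, a k0 ≠ 0 := by
    by_contra hall
    push Not at hall
    have h0 : HasSum (fun k => lam k * a k ^ 2) 0 := by
      have : (fun k => lam k * a k ^ 2) = fun _ => 0 := funext fun k => by rw [hall k]; ring
      rw [this]; exact hasSum_zero
    have := S1.unique h0
    rw [hQ1] at hx
    linarith
  obtain ⟨k0, hk0⟩ := hne
  -- strict comparison `ρ Σ a² < Σ (λ−m)² a²`
  have hlt : ρ * ∑' k, a k ^ 2 <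
      l2 (transferApply β v) (transferApply β v) - 2 * m * l2 v (transferApply β v) + m ^ 2 * ∑' k, a k ^ 2 := by
    refine hasSum_lt (f := fun k => ρ * a k ^ 2) (g := fun k => (lam k - m) ^ 2 * a k ^ 2) (i := k0)
      (fun k => mul_le_mul_of_nonneg_right (hρ k).le (sq_nonneg _)) ?_ (SB.mul_left ρ) hT
    exact mul_lt_mul_of_pos_right (hρ k0) (by positivity)
  -- `⟨v,Kv⟩ ≤ λ_0 Σ a²`
  have hQ1le : l2 v (transferApply β v) ≤ lam 0 * ∑' k, a k ^ 2 :=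
    hasSum_le (fun k => mul_le_mul_of_nonneg_right (hlamle k) (sq_nonneg _)) S1 (SB.mul_left (lam 0))
  have hr0 : 0 ≤ l2Form L (transferOp β x - m • x) (transferOp β x - m • x) := l2Form_self_nonneg _
  rw [hQ1]
  rw [hQ1] at hx
  rcases le_or_gt 0 ρ with hρ0 | hρ0
  · calc ρ * l2 v (transferApply β v) ≤ ρ * (lam 0 * ∑' k, a k ^ 2) := mul_le_mul_of_nonneg_left hQ1le hρ0
      _ = (ρ * ∑' k, a k ^ 2) * lam 0 := by ring
      _ < (l2 (transferApply β v) (transferApply β v) - 2 * m * l2 v (transferApply β v) + m ^ 2 * ∑' k, a k ^ 2) * lam 0 :=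
          mul_lt_mul_of_pos_right hlt hl0
      _ ≤ l2Form L (transferOp β x - m • x) (transferOp β x - m • x) * lam 0 := mul_le_mul_of_nonneg_right hres hl0.le
  · calc ρ * l2 v (transferApply β v) < 0 := mul_neg_of_neg_of_pos hρ0 hx
      _ ≤ l2Form L (transferOp β x - m • x) (transferOp β x - m • x) * lam 0 := mul_nonneg hr0 hl0.le

/-- ★ **WEINSTEIN INCLUSION (located level).**  For a physical `x` with `⟨x,K_βx⟩ > 0` and any real `m`, SOME running level satisfies
`(λ_j − m)²·⟨x,K_βx⟩ ≤ ‖K_βx − m x‖²·λ₀`; for a unit vector with `m = ⟨x,K_βx⟩` its Ritz value this reads `|λ_j − m| ≤ ‖r‖·√(λ₀/m)`.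
[cite: ReedSimonIV1978, Thm. XIII.1] [cite: Kato1949, Lemma 1] -/
theorem inclusion {β : ℝ} (hβ : 0 < β) (x : physSubmodule L) (m : ℝ) (hx : 0 < l2Form L x (transferOp β x)) :
    ∃ j : ℕ, (levelValue su2Rep L β j - m) ^ 2 * l2Form L x (transferOp β x) ≤
      l2Form L (transferOp β x - m • x) (transferOp β x - m • x) * levelValue su2Rep L β 0 := by
  by_contra hall
  push Not at hall
  set R := l2Form L (transferOp β x - m • x) (transferOp β x - m • x) * levelValue su2Rep L β 0 with hR
  have hρ : ∀ k : ℕ, R / l2Form L x (transferOp β x) < (levelValue su2Rep L β k - m) ^ 2 := fun k => by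
    rw [div_lt_iff₀ hx]; exact hall k
  have h := exclusion hβ x m _ hρ hx
  rw [div_mul_cancel₀ R hx.ne'] at h
  exact lt_irrefl _ h

/-- ★ **WEINSTEIN INCLUSION, raw-function form**: for physical `v` with `⟨v,K_βv⟩ > 0` and any real `m`, some running level satisfies
`(λ_j − m)²·⟨v,K_βv⟩ ≤ ‖transferApply β v − m•v‖²·λ₀`. [cite: ReedSimonIV1978, Thm. XIII.1] [cite: Kato1949, Lemma 1] -/
theorem inclusion' {β : ℝ} (hβ : 0 < β) {v : GaugeConfig 3 L SU2 → ℝ} (hv : IsPhys v) (m : ℝ)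
    (hpos : 0 < l2 v (transferApply β v)) :
    ∃ j : ℕ, (levelValue su2Rep L β j - m) ^ 2 * l2 v (transferApply β v) ≤
      l2 (transferApply β v - m • v) (transferApply β v - m • v) * levelValue su2Rep L β 0 := by
  set x : physSubmodule L := ⟨v, hv⟩ with hx
  have hQ1 : l2Form L x (transferOp β x) = l2 v (transferApply β v) := by rw [l2Form_apply, coe_transferOp]
  have hr : l2Form L (transferOp β x - m • x) (transferOp β x - m • x) =
      l2 (transferApply β v - m • v) (transferApply β v - m • v) := by
    rw [l2Form_apply, Submodule.coe_sub, Submodule.coe_smul, coe_transferOp]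
    -- (the coercion identity is the tree's `KTGen.coe_residual`, whose module lies in the route cone; unfolded here instead)
  obtain ⟨j, hj⟩ := inclusion hβ x m (by rw [hQ1]; exact hpos)
  exact ⟨j, by rw [hQ1, hr] at hj; exact hj⟩

/-- **Ritz-value form**: for a physical UNIT vector `v` with Ritz value `q = ⟨v,K_βv⟩ = qform su2Rep β v v > 0` and residual
`r = K_βv − q v`, some running level has `(λ_j − q)²·q ≤ ‖r‖²·λ₀`. [cite: ReedSimonIV1978, Thm. XIII.1] [cite: Kato1949, Lemma 1] -/
theorem inclusion_ritz {β : ℝ} (hβ : 0 < β) {v : GaugeConfig 3 L SU2 → ℝ} (hv : IsPhys v)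
    (hpos : 0 < qform su2Rep β v v) :
    ∃ j : ℕ, (levelValue su2Rep L β j - qform su2Rep β v v) ^ 2 * qform su2Rep β v v ≤
      l2 (transferApply β v - qform su2Rep β v v • v) (transferApply β v - qform su2Rep β v v • v) * levelValue su2Rep L β 0 := by
  have h := inclusion' hβ hv (qform su2Rep β v v) (by rw [← qform_eq_l2_transferApply]; exact hpos)
  rw [← qform_eq_l2_transferApply] at h
  exact h

end Summit.QuantumFields.YangMills.Theorems.FemtoTransferGap.Weinstein

end
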